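import Summits.QuantumAdvantage.QuantumAdvantage.Theorems.CubicForrelationNearExactIsExactCubicFormR4ZLeafData
import Summits.QuantumAdvantage.QuantumAdvantage.Theorems.CubicForrelationNearExactIsExactCubicFormR4ZTools
import Summits.QuantumAdvantage.QuantumAdvantage.Theorems.CubicForrelationNearExactIsExactCubicFormR4ZBudget

/-!
# Crux `CubicForrelation.NearExactIsExact` (stmt-QuantumAdvantage-14043) — E1280-even, R4 branch, descendant `0` (`HZ`): the HYPERPLANE CASE
  modulo the leaf

Certificate seat `b2b-cforr-cert` (gen 43).  HONEST FRAMING: kernel-checked reduction (standard axioms) of R4-PARTNER §4, case `w = 3`, to the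
leaf statement `HLEAF` (the cubic form `d = ỹ∧ω + a∧(Ξ + Σ v_t∧M_t)` with `t̄₇ = 0` has no pairing partner — E1280-HANDPROOFS §2.4, cores
…TwelvePartnerR4LeafZ; its derivation in this coordinate-free form is NOT in this file).  Setting: adapted R4 frame, `t̄₇ = 0`, and the
forms of the cells satisfy `β_v = α(v)·Ξ` for a nonconstant affine `α` and a table `Ξ ≠ 0` (`tq0_hyper`):
* if some cell of `Z₁₀` with `α = 1` weighs `< 48`, its form has rank `2` (…CubicFormR4ZQuad `tq0_rad32`), the `32` radical vectors kill all
  forms (`tq0_row_comb`), and the pigeonhole (★) (…CubicFormR4ZTools `tq0_pigeon`, `32 > 2³`) gives a radical vector of `d`;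
* otherwise the cells with `α = 1` weigh `≥ 48`, so (budget, …CubicFormR4ZBudget) the cells of `Z₁₀ ∩ {α = 0}` are zero cells and `α` is of
  six-point type; …CubicFormR4ZLeafData turns this into the hypotheses of `HLEAF`.
Nothing about `θ₁₂`; NOT summit progress.

References: this seat lineage (g37 R4-PARTNER §3–4, g39 HANDPROOFS §2.4, g43 LEAN-GEN43).  Axioms: the standard three.
-/

set_option linter.dupNamespace false -- D-0017: single-problem summit ⇒ `QuantumAdvantage.QuantumAdvantage` by design

namespace Summit.QuantumAdvantage.QuantumAdvantage.Theorems.CubicForrelation.NearExactIsExact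

open Finset
open Literature.Computability.QuantumComplexity
open Literature.Computability.QuantumComplexity.BuzetChailloux (bxor zeroVec bxor_comm bxor_self bxor_zeroVec zeroVec_bxor
  bxor_bxor_cancel_left)

/-- **Descendant `0`, hyperplane case, modulo the leaf.**  See the module docstring. [this work] -/
theorem tq0_hyper (HLEAF : (∀ (c d : Fin (5 + 7) → Fin (5 + 7) → Fin (5 + 7) → ZMod 2),
      (∀ p j k, c p k j = c p j k) → (∀ p j k, c j p k = c p j k) → (∀ p j, c p j j = 0) →
      (∀ φ j k, d φ k j = d φ j k) → (∀ φ j k, d j φ k = d φ j k) → (∀ φ j, d φ j j = 0) →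
      (∀ p φ, (∑ j, ∑ k, (if j < k then c p j k * d φ j k else 0)) = if p = φ then 1 else 0) →
      (∀ j k, d (Fin.castAdd 7 (0 : Fin 5)) j k =
        (if (j = Fin.castAdd 7 (1 : Fin 5) ∧ k = Fin.castAdd 7 (2 : Fin 5)) ∨ (j = Fin.castAdd 7 (2 : Fin 5) ∧ k = Fin.castAdd 7 (1 : Fin 5)) then 1 else 0) +
        (if (j = Fin.castAdd 7 (3 : Fin 5) ∧ k = Fin.castAdd 7 (4 : Fin 5)) ∨ (j = Fin.castAdd 7 (4 : Fin 5) ∧ k = Fin.castAdd 7 (3 : Fin 5)) then 1 else 0)) →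
      (∀ σ τ υ : Fin 7, d (Fin.natAdd 5 σ) (Fin.natAdd 5 τ) (Fin.natAdd 5 υ) = 0) →
      ∀ (a : Fin 4 → ZMod 2), (∃ t, a t = 1) →
      ∀ (Ξ : Fin 7 → Fin 7 → ZMod 2), (∀ j k, Ξ k j = Ξ j k) → (∀ j, Ξ j j = 0) →
      (∀ (t : Fin 4) (j k : Fin 7), d (Fin.castAdd 7 t.succ) (Fin.natAdd 5 j) (Fin.natAdd 5 k) = a t * Ξ j k) →
      ∀ (E : Fin 7 → ZMod 2) (M : Fin 4 → Fin 7 → ZMod 2),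
      (∀ (t t' : Fin 4) (j : Fin 7), d (Fin.castAdd 7 t.succ) (Fin.castAdd 7 t'.succ) (Fin.natAdd 5 j) =
        ((if (t = 0 ∧ t' = 1) ∨ (t = 1 ∧ t' = 0) then (1 : ZMod 2) else 0) + (if (t = 2 ∧ t' = 3) ∨ (t = 3 ∧ t' = 2) then (1 : ZMod 2) else 0)) * E j + a t * M t' j + a t' * M t j) → False))
    (κ : (Fin (5 + 7) → Bool) → Bool) (hκ : IsDegLeFun 3 κ)
    (c d : Fin (5 + 7) → Fin (5 + 7) → Fin (5 + 7) → ZMod 2)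
    (hcs : ∀ p j k, c p k j = c p j k) (hcc : ∀ p j k, c j p k = c p j k) (hcd : ∀ p j, c p j j = 0)
    (hds : ∀ φ j k, d φ k j = d φ j k) (hdc : ∀ φ j k, d j φ k = d φ j k) (hdd : ∀ φ j, d φ j j = 0)
    (hd : ∀ φ j k, d φ j k =
      if ((((κ zeroVec ^^ κ (bxor zeroVec (fun l => decide (l = k)))) ^^ (κ (bxor zeroVec (fun l => decide (l = j))) ^^ κ (bxor (bxor zeroVec (fun l => decide (l = j))) (fun l => decide (l = k))))) ^^
          ((κ (bxor zeroVec (fun l => decide (l = φ))) ^^ κ (bxor (bxor zeroVec (fun l => decide (l = φ))) (fun l => decide (l = k)))) ^^ (κ (bxor (bxor zeroVec (fun l => decide (l = φ))) (fun l => decide (l = j))) ^^ κ (bxor (bxor (bxor zeroVec (fun l => decide (l = φ))) (fun l => decide (l = j))) (fun l => decide (l = k))))))) = true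
      then 1 else 0)
    (hpair : ∀ p φ, (∑ j, ∑ k, (if j < k then c p j k * d φ j k else 0)) = if p = φ then 1 else 0)
    (hD : ∀ y, (κ y ^^ κ (bxor y (fun l => decide (l = Fin.castAdd 7 (0 : Fin 5))))) =
      ((y (Fin.castAdd 7 (1 : Fin 5)) && y (Fin.castAdd 7 (2 : Fin 5))) ^^ (y (Fin.castAdd 7 (3 : Fin 5)) && y (Fin.castAdd 7 (4 : Fin 5)))))
    (hF : ∀ j k, d (Fin.castAdd 7 (0 : Fin 5)) j k =
      (if (j = Fin.castAdd 7 (1 : Fin 5) ∧ k = Fin.castAdd 7 (2 : Fin 5)) ∨ (j = Fin.castAdd 7 (2 : Fin 5) ∧ k = Fin.castAdd 7 (1 : Fin 5)) then 1 else 0) +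
      (if (j = Fin.castAdd 7 (3 : Fin 5) ∧ k = Fin.castAdd 7 (4 : Fin 5)) ∨ (j = Fin.castAdd 7 (4 : Fin 5) ∧ k = Fin.castAdd 7 (3 : Fin 5)) then 1 else 0))
    (hlt : #(univ.filter fun y : Fin (5 + 7) → Bool => κ y = true) < 1280)
    (hzzz : ∀ σ τ υ : Fin 7, d (Fin.natAdd 5 σ) (Fin.natAdd 5 τ) (Fin.natAdd 5 υ) = 0)
    (e e0 e1 e2 e3 : Bool) (hA : (e0 || e1 || e2 || e3) = true)
    (Ξ : Fin 7 → Fin 7 → Bool) (j₁ k₁ : Fin 7) (hΞ1 : Ξ j₁ k₁ = true)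
    (v₀ : Fin 4 → Bool) (hv₀ : ((((e ^^ (v₀ 0 && e0)) ^^ (v₀ 1 && e1)) ^^ (v₀ 2 && e2)) ^^ (v₀ 3 && e3)) = true)
    (hΞv : ∀ (v : Fin 4 → Bool) (j k : Fin 7), ((κ (Fin.append (Matrix.vecCons false v) zeroVec) ^^ κ (Fin.append (Matrix.vecCons false v) (fun l => decide (l = k)))) ^^ (κ (Fin.append (Matrix.vecCons false v) (fun l => decide (l = j))) ^^ κ (Fin.append (Matrix.vecCons false v) (bxor (fun l => decide (l = j)) (fun l => decide (l = k)))))) = (((((e ^^ (v 0 && e0)) ^^ (v 1 && e1)) ^^ (v 2 && e2)) ^^ (v 3 && e3)) && Ξ j k)) : False := by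
  classical
  -- budget, quadratic cells, weight levels
  have hbudget : #(univ.filter fun s : Fin 7 → Bool => κ (Fin.append (Matrix.vecCons false ![false, false, false, false]) s) = true) + #(univ.filter fun s : Fin 7 → Bool => κ (Fin.append (Matrix.vecCons false ![false, false, false, true]) s) = true) + #(univ.filter fun s : Fin 7 → Bool => κ (Fin.append (Matrix.vecCons false ![false, false, true, false]) s) = true) + #(univ.filter fun s : Fin 7 → Bool => κ (Fin.append (Matrix.vecCons false ![false, true, false, false]) s) = true) + #(univ.filter fun s : Fin 7 → Bool => κ (Fin.append (Matrix.vecCons false ![false, true, false, true]) s) = true) + #(univ.filter fun s : Fin 7 → Bool => κ (Fin.append (Matrix.vecCons false ![false, true, true, false]) s) = true) + #(univ.filter fun s : Fin 7 → Bool => κ (Fin.append (Matrix.vecCons false ![true, false, false, false]) s) = true) + #(univ.filter fun s : Fin 7 → Bool => κ (Fin.append (Matrix.vecCons false ![true, false, false, true]) s) = true) + #(univ.filter fun s : Fin 7 → Bool => κ (Fin.append (Matrix.vecCons false ![true, false, true, false]) s) = true) + #(univ.filter fun s : Fin 7 → Bool => κ (Fin.append (Matrix.vecCons false ![true, true, true,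 true]) s) = true) ≤ 255 := by
    have hwt := tc5_weight κ hD
    have h128 : (2 : ℕ) ^ 7 = 128 := by norm_num
    rw [h128] at hwt
    omega
  have hq : ∀ (v : Fin 4 → Bool) (u' v' w x : Fin 7 → Bool),
      ((((κ (Fin.append (Matrix.vecCons false v) x) ^^ κ (Fin.append (Matrix.vecCons false v) (bxor x w))) ^^ (κ (Fin.append (Matrix.vecCons false v) (bxor x v')) ^^ κ (Fin.append (Matrix.vecCons false v) (bxor (bxor x v') w)))) ^^
          ((κ (Fin.append (Matrix.vecCons false v) (bxor x u')) ^^ κ (Fin.append (Matrix.vecCons false v) (bxor (bxor x u') w))) ^^ (κ (Fin.append (Matrix.vecCons false v) (bxor (bxor x u') v')) ^^ κ (Fin.append (Matrix.vecCons false v) (bxor (bxor (bxor x u') v') w)))))) = false :=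
    fun v u' v' w x => tq0_cells_quadratic κ hκ d hd hzzz (Matrix.vecCons false v) u' v' w x
  have h32 : ∀ v : Fin 4 → Bool, (∀ s, κ (Fin.append (Matrix.vecCons false v) s) = false) ∨ 32 ≤ #(univ.filter fun s : Fin 7 → Bool => κ (Fin.append (Matrix.vecCons false v) s) = true) :=
    fun v => tq0_weight32 (fun s : Fin 7 → Bool => κ (Fin.append (Matrix.vecCons false v) s)) (hq v)
  have hW0 : ∀ v : Fin 4 → Bool, (∀ s, κ (Fin.append (Matrix.vecCons false v) s) = false) → #(univ.filter fun s : Fin 7 → Bool => κ (Fin.append (Matrix.vecCons false v) s) = true) = 0 := by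
    intro v h; rw [card_eq_zero, filter_eq_empty_iff]; intro s _ hs; rw [h s] at hs; exact Bool.false_ne_true hs
  -- at most three cells of `Z₁₀` weigh exactly `64`
  have hT64 : 2 ^ #((univ.filter fun v : Fin 4 → Bool => ((v 0 && v 1) ^^ (v 2 && v 3)) = false).filter fun v => #(univ.filter fun s : Fin 7 → Bool => κ (Fin.append (Matrix.vecCons false v) s) = true) = 64) ≤ 8 := by
    have hsum : (∑ v ∈ univ.filter (fun v : Fin 4 → Bool => ((v 0 && v 1) ^^ (v 2 && v 3)) = false), #(univ.filter fun s : Fin 7 → Bool => κ (Fin.append (Matrix.vecCons false v) s) = true)) ≤ 255 := by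
      rw [tq0_sum_Z10 (fun v => #(univ.filter fun s : Fin 7 → Bool => κ (Fin.append (Matrix.vecCons false v) s) = true))]; exact hbudget
    have hsub := sum_le_sum_of_subset (f := fun v : Fin 4 → Bool => #(univ.filter fun s : Fin 7 → Bool => κ (Fin.append (Matrix.vecCons false v) s) = true))
      (filter_subset (fun v => #(univ.filter fun s : Fin 7 → Bool => κ (Fin.append (Matrix.vecCons false v) s) = true) = 64) (univ.filter fun v : Fin 4 → Bool => ((v 0 && v 1) ^^ (v 2 && v 3)) = false))
    have hconst : (∑ v ∈ (univ.filter fun v : Fin 4 → Bool => ((v 0 && v 1) ^^ (v 2 && v 3)) = false).filter (fun v => #(univ.filter fun s : Fin 7 → Bool => κ (Fin.append (Matrix.vecCons false v) s) = true) = 64), #(univ.filter fun s : Fin 7 → Bool => κ (Fin.append (Matrix.vecCons false v) s) = true)) =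
        64 * #((univ.filter fun v : Fin 4 → Bool => ((v 0 && v 1) ^^ (v 2 && v 3)) = false).filter fun v => #(univ.filter fun s : Fin 7 → Bool => κ (Fin.append (Matrix.vecCons false v) s) = true) = 64) := by
      rw [sum_congr rfl (fun v hv => (mem_filter.mp hv).2), sum_const, smul_eq_mul, mul_comm]
    have h3 : #((univ.filter fun v : Fin 4 → Bool => ((v 0 && v 1) ^^ (v 2 && v 3)) = false).filter fun v => #(univ.filter fun s : Fin 7 → Bool => κ (Fin.append (Matrix.vecCons false v) s) = true) = 64) ≤ 3 := by
      omega
    calc 2 ^ #((univ.filter fun v : Fin 4 → Bool => ((v 0 && v 1) ^^ (v 2 && v 3)) = false).filter fun v => #(univ.filter fun s : Fin 7 → Bool => κ (Fin.append (Matrix.vecCons false v) s) = true) = 64) ≤ 2 ^ 3 :=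
        Nat.pow_le_pow_right (by norm_num) h3
      _ = 8 := by norm_num
  by_cases hlow : ∃ v : Fin 4 → Bool, ((v 0 && v 1) ^^ (v 2 && v 3)) = false ∧ ((((e ^^ (v 0 && e0)) ^^ (v 1 && e1)) ^^ (v 2 && e2)) ^^ (v 3 && e3)) = true ∧ #(univ.filter fun s : Fin 7 → Bool => κ (Fin.append (Matrix.vecCons false v) s) = true) < 48
  · -- RANK 2: the radical of the light cell's form has `32` elements, and kills every form
    obtain ⟨v₁, hv₁, hα₁, hW₁⟩ := hlow
    have hx : ((κ (Fin.append (Matrix.vecCons false v₁) zeroVec) ^^ κ (Fin.append (Matrix.vecCons false v₁) (bxor zeroVec (fun l => decide (l = k₁))))) ^^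
        (κ (Fin.append (Matrix.vecCons false v₁) (bxor zeroVec (fun l => decide (l = j₁)))) ^^ κ (Fin.append (Matrix.vecCons false v₁) (bxor (bxor zeroVec (fun l => decide (l = j₁))) (fun l => decide (l = k₁)))))) = true := by
      simp only [zeroVec_bxor]
      rw [hΞv v₁ j₁ k₁, hα₁, hΞ1]; rfl
    have hrad := tq0_rad32 (fun s : Fin 7 → Bool => κ (Fin.append (Matrix.vecCons false v₁) s)) (hq v₁) (fun l => decide (l = j₁)) (fun l => decide (l = k₁)) hx hW₁
    refine tq0_pigeon κ hκ c d hdc hds hd hpair hF hzzz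
      (univ.filter fun r : Fin 7 → Bool => ∀ y : Fin 7 → Bool,
        ((κ (Fin.append (Matrix.vecCons false v₁) zeroVec) ^^ κ (Fin.append (Matrix.vecCons false v₁) (bxor zeroVec y))) ^^ (κ (Fin.append (Matrix.vecCons false v₁) (bxor zeroVec r)) ^^ κ (Fin.append (Matrix.vecCons false v₁) (bxor (bxor zeroVec r) y)))) = false)
      (fun u hu v k => ?_) (by rw [hrad]; omega)
    have hu' := (mem_filter.mp hu).2 (fun l => decide (l = k))
    simp only [zeroVec_bxor] at hu'
    have hrow := tq0_row_comb (fun s : Fin 7 → Bool => κ (Fin.append (Matrix.vecCons false v) s)) (fun s : Fin 7 → Bool => κ (Fin.append (Matrix.vecCons false v₁) s)) (fun s : Fin 7 → Bool => κ (Fin.append (Matrix.vecCons false v₁) s)) (hq v) (hq v₁) (hq v₁) ((((e ^^ (v 0 && e0)) ^^ (v 1 && e1)) ^^ (v 2 && e2)) ^^ (v 3 && e3)) false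
      (fun j k => by rw [hΞv v j k, hΞv v₁ j k, hα₁, Bool.true_and, Bool.false_and, Bool.xor_false]) u k
    rw [hrow, hu']
    generalize ((((e ^^ (v 0 && e0)) ^^ (v 1 && e1)) ^^ (v 2 && e2)) ^^ (v 3 && e3)) = b
    cases b <;> rfl
  · -- all cells with `α = 1` weigh `≥ 48`: the zero cells are `Z₁₀ ∩ {α = 0}`, `α` is of six-point type, and the leaf applies
    have h48 : ∀ v : Fin 4 → Bool, ((v 0 && v 1) ^^ (v 2 && v 3)) = false → ((((e ^^ (v 0 && e0)) ^^ (v 1 && e1)) ^^ (v 2 && e2)) ^^ (v 3 && e3)) = true → 48 ≤ #(univ.filter fun s : Fin 7 → Bool => κ (Fin.append (Matrix.vecCons false v) s) = true) := by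
      intro v hv hα; by_contra hlt'; exact hlow ⟨v, hv, hα, by omega⟩
    have hzero : ∀ v : Fin 4 → Bool, ((v 0 && v 1) ^^ (v 2 && v 3)) = false → ((((e ^^ (v 0 && e0)) ^^ (v 1 && e1)) ^^ (v 2 && e2)) ^^ (v 3 && e3)) = false → ∀ s : Fin 7 → Bool, κ (Fin.append (Matrix.vecCons false v) s) = false := by
      intro v hv hα
      rcases h32 v with h0 | h32v
      · exact h0
      · exfalso
        have hne : ∃ s, κ (Fin.append (Matrix.vecCons false v) s) = true := by
          by_contra hn
          push Not at hn
          have := hW0 v (fun s => by simpa using hn s)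
          omega
        have h64 := tq0_weight64_of_form_zero (fun s : Fin 7 → Bool => κ (Fin.append (Matrix.vecCons false v) s)) (hq v) (fun j m => by
          have e1 := hΞv v j m; rw [hα, Bool.false_and] at e1; exact e1) hne
        exact tq0_budget_48z (fun v => #(univ.filter fun s : Fin 7 → Bool => κ (Fin.append (Matrix.vecCons false v) s) = true)) hbudget e e0 e1 e2 e3 hA h48 v hv hα h64
    have h6 := tq0_budget_6type (fun v => #(univ.filter fun s : Fin 7 → Bool => κ (Fin.append (Matrix.vecCons false v) s) = true)) hbudget e e0 e1 e2 e3 hA h48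
    obtain ⟨a, Ξ', E', M, ha, hΞs, hΞd, hL, hℓ⟩ := tq0_leaf_data κ hκ d hd e e0 e1 e2 e3 h6 hA Ξ hΞv v₀ hv₀ hzero
    exact HLEAF c d hcs hcc hcd hds hdc hdd hpair hF hzzz a ha Ξ' hΞs hΞd hL E' M hℓ

end Summit.QuantumAdvantage.QuantumAdvantage.Theorems.CubicForrelation.NearExactIsExact
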